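import Literature.Analysis.FluidPDE.KNSSTypeIRateCore
import HarnessLib

/-!
# KNSS 2009, Theorem 6.2: the mildness clause as a named fact, and Steps 5–6 over mild data

Analysis/FluidPDE facts file, third layer of the decomposition of
`Literature.Analysis.FluidPDE.KNSS2009_typeI_rate_rMulNorm_bounded` (`KNSSTypeIRate`; Koch–
Nadirashvili–Seregin–Šverák, *Liouville theorems for the Navier–Stokes equations and
applications*, Acta Math. 203 (2009) = arXiv:0709.3599, Theorem 6.2, main step). The second
layer (`KNSSTypeIRateCore`) cut Steps 5–6 of the printed proof into compactness, the Liouville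
step and the vertex estimate, stated for *classical* doubly rescaled solutions `w⁽ᵏ⁾`. Two of
those three ingredients silently contain the **mildness** of the `w⁽ᵏ⁾` — the representation
formula (3.3), i.e. the Oseen integral equation `w(t) = e^{(t−s)Δ}w(s) − B¹_s(w, w)(t)` — which
the printed proof takes from its first sentence:

> "We have seen in the proof of Theorem 6.1 that (6.4) implies that `u` is a mild solution for
> a suitable initial datum" (arXiv p. 12; proof of Theorem 6.1, last paragraph, p. 12: "It
> remains to show that, under the assumptions of the theorem, `u` is a mild solution. To do this
> we inspect the decomposition of `u` constructed in Lemma 3.1 with `f_k = −u_k u`. Using the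
> decay of the kernel (3.8) and of the heat kernel, it is easy to check that, under the
> assumption (6.1), all the terms in the decomposition `u = v + w + b` will again satisfy (6.1).
> It follows easily that `b` must vanish and therefore `u` is a mild solution."),

and which is also part of the *statement* of Theorem 6.2 ("Moreover, `u` is a mild solution of
the Navier–Stokes equations (for a suitable initial datum)"). This file isolates that content
as ONE named fact about `u`, in the tree's rendering of KNSS's mild solutions by the Oseen
integral equation restarted at every time (`NSBoundedMildOseen`: `heatExtension`,
`oseenDuhamel`; KNSS §3 (3.3), §4 (i) and Remark 4.1, p. 8, "`u = U + B(u, u)` … as an ODE in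
`t`"), and re-states the blow-up fact and the two analytic ingredients over **mild data**:

* `KNSS2009_typeI_rate_mild` — the mildness clause: a classical solution on `ℝ³ × (0, T)`,
  bounded on the sub-slabs, with (assumption2) = (6.4) `|x'|‖u‖ ≤ C` for `|x'| ≥ R₀`, satisfies
  `u(t) = e^{ν(t−s)Δ}u(s) − B^ν_s(u, u)(t)` pointwise for all `0 < s < t < T` (named fact; its
  printed proof is Lemma 3.1 = `KNSS2009_weak_driftMild` plus the decay argument quoted above);
* `KNSS2009_typeI_rate_mildBlowupSequence` — `KNSS2009_typeI_rate_blowupSequence` with the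
  extra hypothesis that every `w⁽ᵏ⁾` satisfies the Oseen integral equation (`ν = 1`) between all
  times of `(A_k, B_k)` (which the rescalings of `u` inherit from the mildness of `u` by the
  scaling covariance of the equation — proved in `KNSSTypeIRateMildProofs`);
* `KNSS2009_typeI_rate_mildCompactness`, `KNSS2009_typeI_rate_mildVertex` — the compactness
  and vertex ingredients of `KNSSTypeIRateCore` over the same mild data (the Liouville
  ingredient `KNSS2009_typeI_rate_liouville` concerns only the limit and is unchanged; it is
  reduced to Theorem 5.1 in `KNSSTypeIRateLiouvilleProofs`).

The proofs file `KNSSTypeIRateMildProofs` establishes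
`KNSS2009_typeI_rate_rMulNorm_bounded_of_mild :
  KNSS2009_typeI_rate_mild → KNSS2009_typeI_rate_mildBlowupSequence →
  KNSS2009_typeI_rate_rMulNorm_bounded` (Steps 2–4 with the Oseen equation threaded through
the two rescalings and the viscosity normalisation) and the glue
`mildCompactness → liouville → mildVertex → mildBlowupSequence`, so that the main step of
Theorem 6.2 rests on the mildness clause, Theorem 5.1, and the two analytic ingredients over
mild data — the latter two being dischargeable from §4 (`KNSS2009_regularity_boundedWeak_window`)
and from the kernel estimates of §3 respectively, which is the remaining programme of the unit.

## Rendering choices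

* (assumption2) is the only decay hypothesis of the mildness fact: the quoted sentences derive
  mildness from (6.4) (resp. (6.1)) alone, through Lemma 3.1, whose proof uses no symmetry; the
  axisymmetry and the Type I bound (6.3) of Theorem 6.2 play no role in it and are not
  repeated. The conclusion is stated between all pairs of times `0 < s < t < T` (Remark 4.1:
  mild on `ℝ³ × (0, T')` for each `T' < T`; restart at intermediate times, §4 p. 8) and
  pointwise (both sides are continuous for a classical solution bounded on `(0, t]`).
* General viscosity `ν > 0` (KNSS: `ν = 1`), as in `KNSS2009_typeI_rate_rMulNorm_bounded`; the
  clock of the free term is `ν(t − s)` and the Duhamel term is `oseenDuhamel ν s`.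

## References

* G. Koch, N. Nadirashvili, G. Seregin, V. Šverák, Acta Math. 203 (2009) 83–105 =
  arXiv:0709.3599 (arXiv pages): Theorem 6.2 (statement, "Moreover, `u` is a mild solution"),
  p. 12; its proof, first sentence, p. 12, and Steps 5–6, p. 13; proof of Theorem 6.1, last
  paragraph, p. 12; Lemma 3.1 and Remark 3.1, p. 7; §4 (i), Remark 4.1, Lemma 4.1, p. 8;
  Lemma 6.1, p. 11. [KochNadirashviliSereginSverak2009]
-/

noncomputable section

open MeasureTheory Set Function Filter TopologicalSpace
open _root_.Topology
open scoped NNReal ENNReal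

namespace Literature.Analysis.FluidPDE

/-- Local notation for physical space `ℝ³ = EuclideanSpace ℝ (Fin 3)`. -/
local notation "ℝ³" => EuclideanSpace ℝ (Fin 3)

/-! ### The mildness clause of Theorem 6.2 -/

/-- **KNSS 2009, Theorem 6.2, the mildness clause** (Acta Math. 203 (2009) = arXiv:0709.3599.
Statement of Theorem 6.2, p. 12: under its hypotheses, "Moreover, `u` is a mild solution of the
Navier–Stokes equations (for a suitable initial datum)"; proof, first sentence, p. 12: "We have
seen in the proof of Theorem 6.1 that (6.4) implies that `u` is a mild solution for a suitable
initial datum and is therefore smooth in open subsets of `ℝ³ × (0, T)`"; the argument is the last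
paragraph of the proof of Theorem 6.1, p. 12: in the decomposition `u = v + w + b` of Lemma 3.1
(`f_k = −u_k u`) all terms inherit the decay at horizontal infinity from `u`, by the decay (3.8)
of the kernel and of the heat kernel, so the parasitic part `b` vanishes and `u` is mild. Mild
solutions: §4 (i), p. 8 — the representation formula (3.3) with `f_k = −u_k u`, i.e. the Oseen
integral equation, well defined on `(0, T')` for every `T' < T` (Remark 4.1) and restarting at
every intermediate time (`u = U + B(u, u)` "as an ODE in `t`", p. 8).) **Statement** (the
tree's rendering: classical solutions for bounded weak ones, the Oseen equation of
`NSBoundedMildOseen` for mildness, general viscosity). Let `ν > 0`, `T > 0`, and let `(u, p)` be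
a classical solution of the unforced Navier–Stokes system on `ℝ³ × (0, T)`, bounded on
`ℝ³ × (0, T')` for every `T' < T`, satisfying (assumption2) = (6.4): for some `R₀ > 0` and `C`,
`|x'| ‖u(t, x)‖ ≤ C` whenever `|x'| ≥ R₀` (`|x'| = cylRadius x`). Then for all `0 < s < t < T` and
all `x`, `u(t, x) = (e^{ν(t−s)Δ}u(s))(x) − B^ν_s(u, u)(t)(x)` (`UnboundedOperators.heatExtension`,
`oseenDuhamel`; pointwise, both sides being continuous). The axisymmetry and the Type I bound
(6.3) of Theorem 6.2 do not enter the quoted argument and are not assumed. In the tree the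
printed proof factors through `KNSS2009_weak_driftMild` (Lemma 3.1 in drift-mild form) and the
decay of the Duhamel and caloric terms; users take `(h : KNSS2009_typeI_rate_mild)`. [cite: KochNadirashviliSereginSverak2009, Thm 6.2 (mildness clause) and its proof, first sentence (arXiv p. 12), with the proof of Thm 6.1, last paragraph (p. 12)] -/
def KNSS2009_typeI_rate_mild : Prop :=
  ∀ ⦃ν T : ℝ⦄ ⦃u : ℝ → ℝ³ → ℝ³⦄ ⦃p : ℝ → ℝ³ → ℝ⦄, 0 < ν → 0 < T →
    IsClassicalNSSolutionOn (Ioo 0 T) ν 0 u p →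
    (∀ T' < T, ∃ M : ℝ, ∀ t ∈ Ioo 0 T', ∀ x, ‖u t x‖ ≤ M) →
    (∃ C R₀ : ℝ, 0 < R₀ ∧ ∀ t ∈ Ioo 0 T, ∀ x, R₀ ≤ cylRadius x → cylRadius x * ‖u t x‖ ≤ C) →
    ∀ ⦃s t : ℝ⦄, 0 < s → s < t → t < T → ∀ x,
      u t x = UnboundedOperators.heatExtension (u s) (ν * (t - s)) x - oseenDuhamel ν s u u t x

/-! ### Steps 5–6 over mild data -/

/-- **KNSS 2009, proof of Theorem 6.2, the compactness–Liouville–vertex step over mild data**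
(Acta Math. 203 (2009) = arXiv:0709.3599, p. 13, from "Since the functions `w⁽ᵏ⁾` are mild
solutions of the Navier–Stokes equations in `(A_k, 0)` (for suitable re-scalings of the initial
datum `u₀`) …" to the end of the proof). This is `KNSS2009_typeI_rate_blowupSequence`
(`KNSSTypeIRate`, whose docstring gives the clause-by-clause correspondence with print) with
the mildness of the `w⁽ᵏ⁾` made an explicit hypothesis, as in the quoted sentence: each `w⁽ᵏ⁾`
satisfies the Oseen integral equation `w⁽ᵏ⁾(t) = e^{(t−s)Δ}w⁽ᵏ⁾(s) − B¹_s(w⁽ᵏ⁾, w⁽ᵏ⁾)(t)`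
pointwise for all `A_k < s < t < B_k` (inherited from the mildness of `u`,
`KNSS2009_typeI_rate_mild`, by the scaling covariance of the equation, proved in
`KNSSTypeIRateMildProofs`). **Statement.** Let `C, K > 0`, `M_k > 0` with `M_k → ∞`,
`A_k → −∞`, `B_k > 0`, and let `(w⁽ᵏ⁾, q⁽ᵏ⁾)` be classical solutions (`ν = 1`) on
`ℝ³ × (A_k, B_k)` satisfying the Oseen integral equation between all times of `(A_k, B_k)`,
each bounded on `ℝ³ × (A_k, 0]`, with slices axisymmetric about the vertical axis through
`c_k = −M_k e₁`, (wkbound3) `√(−τ)‖w⁽ᵏ⁾‖ ≤ C` for `A_k < τ < 0`, (wkbound) `‖w⁽ᵏ⁾‖ ≤ K` for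
`A_k < τ ≤ 0` off the cylinder `{ρ_k ≤ M_k/2}`, and (wkbound2) `‖w⁽ᵏ⁾‖(M_k√(−τ) + ρ_k) ≤ K M_k`
for `A_k < τ ≤ 0`, `ρ_k(x) = cylRadius (x − c_k)`. Then `w⁽ᵏ⁾(0, 0) → 0`. Proved in the tree from
`KNSS2009_typeI_rate_mildCompactness`, `KNSS2009_typeI_rate_liouville` and
`KNSS2009_typeI_rate_mildVertex` (`KNSSTypeIRateMildProofs`); users take
`(h : KNSS2009_typeI_rate_mildBlowupSequence)`. [cite: KochNadirashviliSereginSverak2009, proof of Thm 6.2, last two paragraphs (arXiv p. 13), with Lemma 6.1, Remark 6.1 (p. 11), Thm 5.1 (p. 9), (3.3), (3.8)] -/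
def KNSS2009_typeI_rate_mildBlowupSequence : Prop :=
  ∀ ⦃C K : ℝ⦄ ⦃M A B : ℕ → ℝ⦄ ⦃w : ℕ → ℝ → ℝ³ → ℝ³⦄ ⦃q : ℕ → ℝ → ℝ³ → ℝ⦄,
    0 < C → 0 < K → (∀ k, 0 < M k) → Tendsto M atTop atTop → Tendsto A atTop atBot →
    (∀ k, 0 < B k) →
    (∀ k, IsClassicalNSSolutionOn (Ioo (A k) (B k)) 1 0 (w k) (q k)) →
    (∀ k, ∀ s t : ℝ, A k < s → s < t → t < B k → ∀ x,
      w k t x = UnboundedOperators.heatExtension (w k s) (t - s) x -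
        oseenDuhamel 1 s (w k) (w k) t x) →
    (∀ k, ∃ L : ℝ, ∀ τ ∈ Ioc (A k) 0, ∀ x, ‖w k τ x‖ ≤ L) →
    (∀ k, ∀ τ ∈ Ioo (A k) (B k), ∀ (θ : ℝ) (x : ℝ³),
      w k τ (EuclideanSpace.single 0 (-M k) + rotZ θ (x - EuclideanSpace.single 0 (-M k))) =
        rotZ θ (w k τ x)) →
    (∀ k, ∀ τ ∈ Ioo (A k) 0, ∀ x, Real.sqrt (-τ) * ‖w k τ x‖ ≤ C) →
    (∀ k, ∀ τ ∈ Ioc (A k) 0, ∀ x,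
      M k / 2 < cylRadius (x - EuclideanSpace.single 0 (-M k)) → ‖w k τ x‖ ≤ K) →
    (∀ k, ∀ τ ∈ Ioc (A k) 0, ∀ x,
      ‖w k τ x‖ * (M k * Real.sqrt (-τ) + cylRadius (x - EuclideanSpace.single 0 (-M k))) ≤
        K * M k) →
    Tendsto (fun k => w k 0 0) atTop (𝓝 0)

/-- **KNSS 2009, Lemma 6.1 in the form used in the proof of Theorem 6.2, over mild data** (Acta
Math. 203 (2009) = arXiv:0709.3599; Lemma 6.1, p. 11: "Assume that `u_l` is a sequence of bounded
mild solutions of Navier–Stokes defined in `ℝⁿ × (T_l, 0)` (for some initial data) with a uniform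
bound `|u_l| ≤ C`, and `T_l ↘ −∞`. Then we can choose a subsequence such that along the
subsequence the `u_l` converge locally uniformly in `ℝⁿ × (−∞, 0)` to an ancient mild solution `u`
satisfying `|u| ≤ C`", an "easy consequence of the results in Section 4"; its use, p. 13: "Since
the functions `w⁽ᵏ⁾` are mild solutions … in view of bound (wkbound3) we can choose a subsequence
… such that the `w⁽ᵏ⁾` converge uniformly on compact subsets of `ℝ³ × (−∞, 0)` to an ancient mild
solution `w`.") This is `KNSS2009_typeI_rate_compactness` (`KNSSTypeIRateCore`, same rendering of
the limit: joint continuity, weakly divergence-free slices, the bound `√(−t)‖W‖ ≤ C`, the Oseen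
integral equation between all `s < t < 0`, slice-wise locally uniform convergence along a
subsequence) with the mildness of the `w⁽ᵏ⁾` — the printed hypothesis of Lemma 6.1 — made
explicit: the `w⁽ᵏ⁾` satisfy the Oseen integral equation between all times of `(A_k, B_k)`.
**Statement.** For `C, K > 0`, `M_k > 0` with `M_k → ∞`, `A_k → −∞`, `B_k > 0`, classical
solutions `(w⁽ᵏ⁾, q⁽ᵏ⁾)` (`ν = 1`) on `ℝ³ × (A_k, B_k)` satisfying the Oseen equation there, each
bounded on `ℝ³ × (A_k, 0]`, with (wkbound3) and (wkbound2): there are a subsequence `φ` and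
`W : ℝ → ℝ³ → ℝ³`, jointly continuous on `(−∞, 0) × ℝ³`, with weakly divergence-free slices,
`√(−t)‖W(t, x)‖ ≤ C`, satisfying `W(t) = e^{(t−s)Δ}W(s) − B¹_s(W, W)(t)` pointwise for all
`s < t < 0`, such that `w⁽ᵠ⁽ᵏ⁾⁾(·, t) → W(·, t)` locally uniformly for every `t < 0`. In the tree
this is to be DERIVED from §4 (`KNSS2009_regularity_boundedWeak_window`, via the Lipschitz
bounds of `KNSSWindowLipschitz` on the windows inside `(−∞, −δ]`, Arzelà–Ascoli, and dominated
convergence in the Oseen equation); users take `(h : KNSS2009_typeI_rate_mildCompactness)`. [cite: KochNadirashviliSereginSverak2009, Lemma 6.1 (arXiv p. 11) and proof of Thm 6.2 (p. 13)] -/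
def KNSS2009_typeI_rate_mildCompactness : Prop :=
  ∀ ⦃C K : ℝ⦄ ⦃M A B : ℕ → ℝ⦄ ⦃w : ℕ → ℝ → ℝ³ → ℝ³⦄ ⦃q : ℕ → ℝ → ℝ³ → ℝ⦄,
    0 < C → 0 < K → (∀ k, 0 < M k) → Tendsto M atTop atTop → Tendsto A atTop atBot →
    (∀ k, 0 < B k) →
    (∀ k, IsClassicalNSSolutionOn (Ioo (A k) (B k)) 1 0 (w k) (q k)) →
    (∀ k, ∀ s t : ℝ, A k < s → s < t → t < B k → ∀ x,
      w k t x = UnboundedOperators.heatExtension (w k s) (t - s) x -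
        oseenDuhamel 1 s (w k) (w k) t x) →
    (∀ k, ∃ L : ℝ, ∀ τ ∈ Ioc (A k) 0, ∀ x, ‖w k τ x‖ ≤ L) →
    (∀ k, ∀ τ ∈ Ioo (A k) 0, ∀ x, Real.sqrt (-τ) * ‖w k τ x‖ ≤ C) →
    (∀ k, ∀ τ ∈ Ioc (A k) 0, ∀ x,
      ‖w k τ x‖ * (M k * Real.sqrt (-τ) + cylRadius (x - EuclideanSpace.single 0 (-M k))) ≤
        K * M k) →
    ∃ (φ : ℕ → ℕ) (W : ℝ → ℝ³ → ℝ³), StrictMono φ ∧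
      ContinuousOn (uncurry W) (Iio 0 ×ˢ univ) ∧
      (∀ t < 0, IsWeaklyDivFree (W t)) ∧
      (∀ t < 0, ∀ x, Real.sqrt (-t) * ‖W t x‖ ≤ C) ∧
      (∀ s t : ℝ, s < t → t < 0 → ∀ x,
        W t x = UnboundedOperators.heatExtension (W s) (t - s) x - oseenDuhamel 1 s W W t x) ∧
      (∀ t < 0, TendstoLocallyUniformly (fun k => w (φ k) t) (W t) atTop)

/-- **KNSS 2009, the vertex estimate of the proof of Theorem 6.2, over mild data** (Acta Math.
203 (2009) = arXiv:0709.3599, p. 13, last paragraph: "… `w⁽ᵏ⁾(0, 0) → w(0, 0)`, which is not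
immediately obvious since our bound of `sup_x |w⁽ᵏ⁾(x, τ)|` may not be uniform as `τ → 0`.
However, by (wkbound) the only possible problem may occur due to the contribution from the
cylinder `𝒞_k`. … Applying the representation formula (3.3) in `ℝ³ × (−1, 0)` with
`w⁽ᵏ⁾(x, −1)` as initial datum and `f_{jl} = −w⁽ᵏ⁾_l w⁽ᵏ⁾_j` and using the bound (wkbound2)
together with the decay of the kernel (3.8), one sees that it is enough to estimate the
integral `I(M)` … `I(M) → 0` as `M → ∞` … and therefore (by (estimates1)) the sequence `w⁽ᵏ⁾`
converges to `w` uniformly in `B̄(0, 1) × [−1, 0]`.") This is `KNSS2009_typeI_rate_vertex`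
(`KNSSTypeIRateCore`: asymptotic equicontinuity in time at the vertex) with the representation
formula (3.3) for the `w⁽ᵏ⁾` — the Oseen integral equation between all times of `(A_k, B_k)`,
in particular on `(−1, 0]` — made an explicit hypothesis, as it is used in the quoted passage.
**Statement.** For `C, K > 0`, `M_k > 0` with `M_k → ∞`, `A_k → −∞`, `B_k > 0`, classical
solutions `(w⁽ᵏ⁾, q⁽ᵏ⁾)` (`ν = 1`) on `ℝ³ × (A_k, B_k)` satisfying the Oseen equation there,
each bounded on `ℝ³ × (A_k, 0]`, with (wkbound3), (wkbound) (`‖w⁽ᵏ⁾‖ ≤ K` off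
`𝒞_k = {ρ_k ≤ M_k/2}`, `A_k < τ ≤ 0`) and (wkbound2): for every `ε > 0` there is `δ > 0` such
that for all large `k` and all `τ ∈ [−δ, 0]`, `‖w⁽ᵏ⁾(0, 0) − w⁽ᵏ⁾(0, τ)‖ ≤ ε`. With the Oseen
equation in hand this is a statement about the kernels of §3 only ((3.8), the estimates
(3.10)–(3.14), `I(M) → 0`); users take `(h : KNSS2009_typeI_rate_mildVertex)`. [cite: KochNadirashviliSereginSverak2009, proof of Thm 6.2, last paragraph (arXiv p. 13), with (3.3) and (3.8) (pp. 6–7)] -/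
def KNSS2009_typeI_rate_mildVertex : Prop :=
  ∀ ⦃C K : ℝ⦄ ⦃M A B : ℕ → ℝ⦄ ⦃w : ℕ → ℝ → ℝ³ → ℝ³⦄ ⦃q : ℕ → ℝ → ℝ³ → ℝ⦄,
    0 < C → 0 < K → (∀ k, 0 < M k) → Tendsto M atTop atTop → Tendsto A atTop atBot →
    (∀ k, 0 < B k) →
    (∀ k, IsClassicalNSSolutionOn (Ioo (A k) (B k)) 1 0 (w k) (q k)) →
    (∀ k, ∀ s t : ℝ, A k < s → s < t → t < B k → ∀ x,
      w k t x = UnboundedOperators.heatExtension (w k s) (t - s) x -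
        oseenDuhamel 1 s (w k) (w k) t x) →
    (∀ k, ∃ L : ℝ, ∀ τ ∈ Ioc (A k) 0, ∀ x, ‖w k τ x‖ ≤ L) →
    (∀ k, ∀ τ ∈ Ioo (A k) 0, ∀ x, Real.sqrt (-τ) * ‖w k τ x‖ ≤ C) →
    (∀ k, ∀ τ ∈ Ioc (A k) 0, ∀ x,
      M k / 2 < cylRadius (x - EuclideanSpace.single 0 (-M k)) → ‖w k τ x‖ ≤ K) →
    (∀ k, ∀ τ ∈ Ioc (A k) 0, ∀ x,
      ‖w k τ x‖ * (M k * Real.sqrt (-τ) + cylRadius (x - EuclideanSpace.single 0 (-M k))) ≤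
        K * M k) →
    ∀ ε > 0, ∃ δ > 0, ∀ᶠ k in atTop, ∀ τ ∈ Icc (-δ) 0, ‖w k 0 0 - w k τ 0‖ ≤ ε

/-! ### The old ingredients imply the new ones (sanity: the new facts are weaker) -/

/-- `KNSS2009_typeI_rate_blowupSequence → KNSS2009_typeI_rate_mildBlowupSequence` (the new fact
has one more hypothesis). [folklore] -/
theorem KNSS2009_typeI_rate_mildBlowupSequence_of_blowupSequence
    (h : KNSS2009_typeI_rate_blowupSequence) : KNSS2009_typeI_rate_mildBlowupSequence :=
  fun _C _K _M _A _B _w _q hC hK hMpos hMlim hAlim hBpos hw _hmild hL hsym hI hoff hmul =>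
    h hC hK hMpos hMlim hAlim hBpos hw hL hsym hI hoff hmul

/-- `KNSS2009_typeI_rate_compactness → KNSS2009_typeI_rate_mildCompactness`. [folklore] -/
theorem KNSS2009_typeI_rate_mildCompactness_of_compactness
    (h : KNSS2009_typeI_rate_compactness) : KNSS2009_typeI_rate_mildCompactness :=
  fun _C _K _M _A _B _w _q hC hK hMpos hMlim hAlim hBpos hw _hmild hL hI hmul =>
    h hC hK hMpos hMlim hAlim hBpos hw hL hI hmul

/-- `KNSS2009_typeI_rate_vertex → KNSS2009_typeI_rate_mildVertex`. [folklore] -/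
theorem KNSS2009_typeI_rate_mildVertex_of_vertex
    (h : KNSS2009_typeI_rate_vertex) : KNSS2009_typeI_rate_mildVertex :=
  fun _C _K _M _A _B _w _q hC hK hMpos hMlim hAlim hBpos hw _hmild hL hI hoff hmul =>
    h hC hK hMpos hMlim hAlim hBpos hw hL hI hoff hmul

end Literature.Analysis.FluidPDE

end
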